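import Summits.ABC.IUTFork.BrobergAdmissible
import Summits.ABC.IUTFork.FrobeniusCertificateNumberField
import Literature.NumberTheory.EllipticCurves.PointCountEulerCriterion
import Literature.NumberTheory.EllipticCurves.ComplexMultiplicationLocalFactorsAux
import Mathlib.LinearAlgebra.FreeModule.IdealQuotient
import HarnessLib

/-!
# (P6) at Broberg's quadratic point, part 1: the `𝓞_K`-model `E₁` of `y² = x(x−1)(x−λ)` over `ℚ(√7)` and the FROBENIUS
# CERTIFICATE at `𝔮 = (3 + 2√7)` — `E_λ[7]` and `E_λ[11]` are irreducible `Γ_{ℚ(√7)}`-modules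

PROOF-ONLY file (0 definitions, 0 `Prop` facts, no instance, no notation) of the abc-iut cell (D-0079 RESCUE sub-cell R-W,
W1 ROW DECISIONS seat abc-iut-W-row-2, gen 5); classical arithmetic of ONE elliptic curve over `ℚ(√7)`; TAKES NO SIDE on
[IUTchIII] Cor. 3.12 or on any author. First half of the kernel discharge of `Cor22.CondP6 Broberg.point 7 / 11` (rows 9/10 of
HOME/plan/rescue/R-W/OPEN-10.md; the sequel `BrobergCondP6.lean` finishes). With `λ = a/c`, `a = −ε′³ϖ₃ = 1307 − 494√7`,
`c = ϖ₄₇⁴ = 10273 − 3792√7` (`BrobergPoint.lam_eq`):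
* §1 generic identities for the model `[0, −(c²+ac), 0, ac³, 0]` of `y² = x(x−c²)(x−ac)` over any ring: `Δ = 16a²(c−a)²c⁸`,
  `c₄ = 16c²(c²−ac+a²)`, functoriality, and the rescaling `⟨c,0,0,0⟩ • [..] = [0, −(1+a/c), 0, a/c, 0]` over a field;
* §2 the CERTIFICATE PRIME `𝔮 = (3 + 2√7)` of `𝓞_K`, `N𝔮 = 19`, `𝓞_K/𝔮 ≅ 𝔽₁₉` with `√7 ↦ 8` (`ZMod.ringEquivOfPrime`):
  `E₁ mod 𝔮 = [0, 3, 0, 15, 0]`, `#Ẽ₁(𝔽₁₉) = 24` (kernel count by Euler's criterion, `card_sol_eq_sum_euler`), so `a_𝔮 = −4`;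
  `Δ(E₁) ∉ 𝔮`; `X² + 4X + 19` has no root mod `7` (discriminant `≡ 3`) nor mod `11` (`≡ 6`); hence by the number-field Frobenius
  certificate `hasIrreducibleModPGaloisRep_baseChange_of_certificate` (`FrobeniusCertificateNumberField`, Mazur 1978 Prop. 6.3 (1)
  over `K`): **`hasIrreducibleModPGaloisRep_seven / _eleven` — `E₁[7]`, `E₁[11]` are irreducible `Γ_{ℚ(√7)}`-modules**
  (no `ℚ(√7)`-rational `7`- or `11`-isogeny).
Desk numbers (HOME/abc-iut-W-row-2 gen 5, work/cert.py): `N(Δ(E₁)) = 2¹⁴3²⁶47³²`; in `𝔽₁₉`: `ε′ ↦ 3`, `ϖ₃ ↦ 10`, `ϖ₄₇ ↦ 1`,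
`ā = 15`, `c̄ = 1`. [cite: Mazur1978, §6 Prop. 6.3 (1) p. 153] [cite: SilvermanAEC2009, III.1 (b₂–b₈, c₄, Δ), Table 3.1]
[cite: NeukirchANT1999, Ch. I §8] [cite: Mochizuki2012, IUTchIV Cor. 2.2 (ii) proof (P6) p. 46] for the purpose only.
-/

noncomputable section

open scoped Classical NumberField

open NumberField IsDedekindDomain IsDedekindDomain.HeightOneSpectrum WeierstrassCurve QuadraticAlgebra

namespace Summit.ABC.IUTFork.Broberg

open Sqrt7 Literature.IUT.LogVolume Literature.NumberTheory.NumberFields Literature.NumberTheory.EllipticCurves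
  Literature.NumberTheory.DiophantineGeometry.GenEll Literature.NumberTheory.DiophantineGeometry

/-! ## §1 Generic identities for the model `[0, −(c²+ac), 0, ac³, 0]` of `y² = x(x − c²)(x − ac)` -/

section Model

variable {R : Type*} [CommRing R]

/-- `Δ[0, −(c²+ac), 0, ac³, 0] = 16 a² (c−a)² c⁸`. [cite: SilvermanAEC2009, III.1 (b₂, b₄, b₆, b₈, Δ)] -/
theorem model_Δ (a c : R) :
    (⟨0, -(c ^ 2 + a * c), 0, a * c ^ 3, 0⟩ : WeierstrassCurve R).Δ = 16 * a ^ 2 * (c - a) ^ 2 * c ^ 8 := by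
  simp only [WeierstrassCurve.Δ, WeierstrassCurve.b₂, WeierstrassCurve.b₄, WeierstrassCurve.b₆, WeierstrassCurve.b₈]
  ring

/-- `c₄[0, −(c²+ac), 0, ac³, 0] = 16 c² (c² − ac + a²)`. [cite: SilvermanAEC2009, III.1 (c₄)] -/
theorem model_c₄ (a c : R) :
    (⟨0, -(c ^ 2 + a * c), 0, a * c ^ 3, 0⟩ : WeierstrassCurve R).c₄ = 16 * c ^ 2 * (c ^ 2 - a * c + a ^ 2) := by
  simp only [WeierstrassCurve.c₄, WeierstrassCurve.b₂, WeierstrassCurve.b₄]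
  ring

/-- The model is functorial: `[0, −(c²+ac), 0, ac³, 0].map f = [0, −(f(c)²+f(a)f(c)), 0, f(a)f(c)³, 0]`. [folklore] -/
theorem model_map {S : Type*} [CommRing S] (f : R →+* S) (a c : R) :
    (⟨0, -(c ^ 2 + a * c), 0, a * c ^ 3, 0⟩ : WeierstrassCurve R).map f = ⟨0, -(f c ^ 2 + f a * f c), 0, f a * f c ^ 3, 0⟩ := by
  ext <;> simp [WeierstrassCurve.map]

/-- Over a field, rescaling by `u = c ≠ 0` turns the model into the Legendre equation of `λ = a/c`:
`⟨c, 0, 0, 0⟩ • [0, −(c²+ac), 0, ac³, 0] = [0, −(1 + a/c), 0, a/c, 0]`. [cite: SilvermanAEC2009, III.1 Table 3.1] -/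
theorem model_rescale {F : Type*} [Field F] (a c : F) (hc : c ≠ 0) :
    (⟨Units.mk0 c hc, 0, 0, 0⟩ : VariableChange F) • (⟨0, -(c ^ 2 + a * c), 0, a * c ^ 3, 0⟩ : WeierstrassCurve F) =
      ⟨0, -(1 + a / c), 0, a / c, 0⟩ := by
  ext
  · simp [variableChange_a₁]
  · rw [variableChange_a₂]; simp [Units.val_inv_eq_inv_val]; field_simp
  · simp [variableChange_a₃]
  · rw [variableChange_a₄]; simp [Units.val_inv_eq_inv_val]; field_simp
  · simp [variableChange_a₆]

end Model

/-! ## §2 The certificate prime `𝔮 = (3 + 2√7)` of norm `19` -/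

/-- `(3 + 2√7)(2√7 − 3) = 19` in `𝓞 K`. [folklore] -/
theorem ϖ₁₉_mul : (3 + 2 * sqrt7Int : 𝓞 K) * (2 * sqrt7Int - 3) = 19 := by
  linear_combination (4 : 𝓞 K) * sqrt7Int_sq

/-- `3 + 2√7` in `K`. [folklore] -/
theorem coe_ϖ₁₉ : (((3 + 2 * sqrt7Int : 𝓞 K) : 𝓞 K) : K) = 3 + 2 * sqrt7 := by simp [map_ofNat]

/-- `3 + 2√7 ≠ 0` in `K`. [folklore] -/
theorem coe_ϖ₁₉_ne_zero : (((3 + 2 * sqrt7Int : 𝓞 K) : 𝓞 K) : K) ≠ 0 := by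
  rw [coe_ϖ₁₉]
  intro h
  have := congrArg QuadraticAlgebra.im h
  simp [sqrt7] at this

/-- `N((3 + 2√7)) = 19` (`3² − 7·2² = −19`). [folklore] -/
theorem absNorm_span_ϖ₁₉ : Ideal.absNorm (Ideal.span {(3 + 2 * sqrt7Int : 𝓞 K)}) = 19 :=
  absNorm_span_eq (by rw [coe_ϖ₁₉]; simp [sqrt7]; norm_num)

/-- `(3 + 2√7)` is a maximal ideal of `𝓞 K`. [folklore] -/
theorem span_ϖ₁₉_isMaximal : (Ideal.span {(3 + 2 * sqrt7Int : 𝓞 K)}).IsMaximal :=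
  span_isMaximal_of_absNorm (by norm_num) absNorm_span_ϖ₁₉

/-- Any ring map `ψ : 𝓞 K → ℤ/19` with `ψ(√7) = 8` sends `ε′ = 8 − 3√7 ↦ 3`, `ϖ₃ = 2 + √7 ↦ 10`, `ϖ₄₇ = 3√7 − 4 ↦ 1`. [folklore] -/
theorem map_units_nineteen (ψ : 𝓞 K →+* ZMod 19) (hψ : ψ sqrt7Int = 8) :
    ψ eps' = 3 ∧ ψ ϖ₃ = 10 ∧ ψ ϖ₄₇ = 1 := by
  simp only [eps', ϖ₃, ϖ₄₇, map_sub, map_add, map_mul, map_ofNat, hψ]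
  decide

/-- **`E₁ mod 𝔮 = [0, 3, 0, 15, 0]` over `𝔽₁₉`** for every ring map `ψ : 𝓞 K → ℤ/19` with `ψ(√7) = 8` (`ā = −27·10 = 15`, `c̄ = 1`).
[folklore] -/
theorem model_map_nineteen (ψ : 𝓞 K →+* ZMod 19) (hψ : ψ sqrt7Int = 8) :
    (⟨0, -((ϖ₄₇ ^ 4) ^ 2 + -(eps' ^ 3 * ϖ₃) * ϖ₄₇ ^ 4), 0, -(eps' ^ 3 * ϖ₃) * (ϖ₄₇ ^ 4) ^ 3, 0⟩ : WeierstrassCurve (𝓞 K)).map ψ =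
      ⟨0, 3, 0, 15, 0⟩ := by
  obtain ⟨h1, h2, h3⟩ := map_units_nineteen ψ hψ
  rw [model_map]
  simp only [map_pow, map_neg, map_mul, h1, h2, h3]
  ext <;> decide

/-- **`#Ẽ₁(𝔽₁₉) = 24`** for `Ẽ₁ = [0, 3, 0, 15, 0]` (kernel count by Euler's criterion, column by column). [folklore] -/
theorem natCard_point_nineteen : Nat.card (⟨0, 3, 0, 15, 0⟩ : WeierstrassCurve (ZMod 19)).toAffine.Point = 24 := by
  rw [@WeierstrassCurve.natCard_point_eq_one_add_card (ZMod 19) (@ZMod.instField 19 ⟨by norm_num⟩) _ _ _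
    (by decide +kernel), @card_sol_eq_sum_euler (ZMod 19) (@ZMod.instField 19 ⟨by norm_num⟩) _ _
    (by rw [ZMod.ringChar_zmod_n]; decide)]
  decide +kernel

/-- `Δ[0, 3, 0, 15, 0] ≠ 0` in `𝔽₁₉` (`= 16·15²·(9 − 60) ≡ 16`). [folklore] -/
theorem Δ_nineteen_ne_zero : (⟨0, 3, 0, 15, 0⟩ : WeierstrassCurve (ZMod 19)).Δ ≠ 0 := by
  decide +kernel

/-- `X² − (19 + 1 − 24)·X + 19 = X² + 4X + 19` has no root in `𝔽₇` (discriminant `−60 ≡ 3`, a non-residue mod `7`). [folklore] -/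
theorem noroot_seven : ∀ t : ZMod 7,
    t ^ 2 - ((((19 : ℕ) : ℤ) + 1 - ((24 : ℕ) : ℤ) : ℤ) : ZMod 7) * t + ((19 : ℕ) : ZMod 7) ≠ 0 := by
  decide

/-- `X² + 4X + 19` has no root in `𝔽₁₁` (discriminant `−60 ≡ 6`, a non-residue mod `11`). [folklore] -/
theorem noroot_eleven : ∀ t : ZMod 11,
    t ^ 2 - ((((19 : ℕ) : ℤ) + 1 - ((24 : ℕ) : ℤ) : ℤ) : ZMod 11) * t + ((19 : ℕ) : ZMod 11) ≠ 0 := by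
  decide

section CertificatePrime

variable (v : HeightOneSpectrum (𝓞 K)) (hv : v.asIdeal = Ideal.span {(3 + 2 * sqrt7Int : 𝓞 K)})
include hv

/-- `19 ∈ 𝔮`. [folklore] -/
theorem nineteen_mem : ((19 : ℕ) : 𝓞 K) ∈ v.asIdeal := by
  rw [hv, Nat.cast_ofNat, ← ϖ₁₉_mul]
  exact Ideal.mul_mem_right _ _ (Ideal.mem_span_singleton_self _)

/-- `#(𝓞 K / 𝔮) = 19`. [folklore] -/
theorem natCard_quotient_eq : Nat.card (𝓞 K ⧸ v.asIdeal) = 19 := by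
  rw [← Submodule.cardQuot_apply, ← Ideal.absNorm_apply, hv, absNorm_span_ϖ₁₉]

/-- **`𝓞 K / 𝔮 ≅ 𝔽₁₉` with `√7 ↦ 8`**: there is a ring isomorphism `e : 𝓞 K / 𝔮 ≃+* ℤ/19` with `e(√7) = 8` (`3 + 2·8 = 19`).
[folklore] -/
theorem exists_ringEquiv_zmod_nineteen :
    ∃ e : 𝓞 K ⧸ v.asIdeal ≃+* ZMod 19, e (Ideal.Quotient.mk v.asIdeal sqrt7Int) = 8 := by
  haveI : Finite (𝓞 K ⧸ v.asIdeal) := Ideal.finiteQuotientOfFreeOfNeBot v.asIdeal v.ne_bot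
  letI : Fintype (𝓞 K ⧸ v.asIdeal) := Fintype.ofFinite _
  have hcard : Fintype.card (𝓞 K ⧸ v.asIdeal) = 19 := by
    rw [← Nat.card_eq_fintype_card, natCard_quotient_eq v hv]
  set e := (ZMod.ringEquivOfPrime (𝓞 K ⧸ v.asIdeal) (by norm_num) hcard).symm with he
  refine ⟨e, ?_⟩
  have h0 : e (Ideal.Quotient.mk v.asIdeal (3 + 2 * sqrt7Int)) = 0 := by
    rw [Ideal.Quotient.eq_zero_iff_mem.mpr (by rw [hv]; exact Ideal.mem_span_singleton_self _), map_zero]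
  rw [map_add, map_mul, map_ofNat, map_ofNat, map_add, map_mul, map_ofNat, map_ofNat] at h0
  generalize e (Ideal.Quotient.mk v.asIdeal sqrt7Int) = s at h0 ⊢
  revert s
  decide

/-- **`#(E₁ mod 𝔮)(𝓞 K/𝔮) = 24`**. [folklore] -/
theorem natCard_point_model_quotient :
    Nat.card (((⟨0, -((ϖ₄₇ ^ 4) ^ 2 + -(eps' ^ 3 * ϖ₃) * ϖ₄₇ ^ 4), 0, -(eps' ^ 3 * ϖ₃) * (ϖ₄₇ ^ 4) ^ 3, 0⟩ :
      WeierstrassCurve (𝓞 K)).map (Ideal.Quotient.mk v.asIdeal)).toAffine.Point) = 24 := by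
  obtain ⟨e, he⟩ := exists_ringEquiv_zmod_nineteen v hv
  have hψ : ((e : 𝓞 K ⧸ v.asIdeal →+* ZMod 19).comp (Ideal.Quotient.mk v.asIdeal)) sqrt7Int = 8 := he
  rw [← natCard_point_map_ringEquiv e, WeierstrassCurve.map_map, model_map_nineteen _ hψ, natCard_point_nineteen]

/-- **`Δ(E₁) ∉ 𝔮`** (`E₁` has good reduction at `𝔮`). [folklore] -/
theorem model_Δ_not_mem :
    (⟨0, -((ϖ₄₇ ^ 4) ^ 2 + -(eps' ^ 3 * ϖ₃) * ϖ₄₇ ^ 4), 0, -(eps' ^ 3 * ϖ₃) * (ϖ₄₇ ^ 4) ^ 3, 0⟩ :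
      WeierstrassCurve (𝓞 K)).Δ ∉ v.asIdeal := by
  obtain ⟨e, he⟩ := exists_ringEquiv_zmod_nineteen v hv
  have hψ : ((e : 𝓞 K ⧸ v.asIdeal →+* ZMod 19).comp (Ideal.Quotient.mk v.asIdeal)) sqrt7Int = 8 := he
  intro hmem
  apply Δ_nineteen_ne_zero
  rw [← model_map_nineteen _ hψ, map_Δ, RingHom.comp_apply, Ideal.Quotient.eq_zero_iff_mem.mpr hmem, map_zero]

/-- `7 ∉ 𝔮` (`3·19 − 8·7 = 1`). [folklore] -/
theorem seven_not_mem : ((7 : ℕ) : 𝓞 K) ∉ v.asIdeal := natCast_not_mem_of_coprime v (nineteen_mem v hv) (by norm_num)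

/-- `11 ∉ 𝔮` (`7·11 − 4·19 = 1`). [folklore] -/
theorem eleven_not_mem : ((11 : ℕ) : 𝓞 K) ∉ v.asIdeal := natCast_not_mem_of_coprime v (nineteen_mem v hv) (by norm_num)

/-- **`E_λ[7]` is an irreducible `Γ_{ℚ(√7)}`-module** (Frobenius certificate at `𝔮`: `a_𝔮 = 19 + 1 − 24 = −4`, `X² + 4X + 19` has
discriminant `−60 ≡ 3`, a non-residue mod `7`). [cite: Mazur1978, §6 Prop. 6.3 (1) p. 153] -/
theorem hasIrreducibleModPGaloisRep_seven :
    ((⟨0, -((ϖ₄₇ ^ 4) ^ 2 + -(eps' ^ 3 * ϖ₃) * ϖ₄₇ ^ 4), 0, -(eps' ^ 3 * ϖ₃) * (ϖ₄₇ ^ 4) ^ 3, 0⟩ :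
      WeierstrassCurve (𝓞 K)).baseChange K).HasIrreducibleModPGaloisRep 7 := by
  haveI : Fact (Nat.Prime 7) := ⟨by norm_num⟩
  refine hasIrreducibleModPGaloisRep_baseChange_of_certificate _ 7 v (model_Δ_not_mem v hv) (seven_not_mem v hv) ?_
  intro t
  rw [natCard_quotient_eq v hv, natCard_point_model_quotient v hv]
  revert t
  exact noroot_seven

/-- **`E_λ[11]` is an irreducible `Γ_{ℚ(√7)}`-module** (same certificate: `X² + 4X + 19` has discriminant `−60 ≡ 6`, a non-residue
mod `11`). [cite: Mazur1978, §6 Prop. 6.3 (1) p. 153] -/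
theorem hasIrreducibleModPGaloisRep_eleven :
    ((⟨0, -((ϖ₄₇ ^ 4) ^ 2 + -(eps' ^ 3 * ϖ₃) * ϖ₄₇ ^ 4), 0, -(eps' ^ 3 * ϖ₃) * (ϖ₄₇ ^ 4) ^ 3, 0⟩ :
      WeierstrassCurve (𝓞 K)).baseChange K).HasIrreducibleModPGaloisRep 11 := by
  haveI : Fact (Nat.Prime 11) := ⟨by norm_num⟩
  refine hasIrreducibleModPGaloisRep_baseChange_of_certificate _ 11 v (model_Δ_not_mem v hv) (eleven_not_mem v hv) ?_
  intro t
  rw [natCard_quotient_eq v hv, natCard_point_model_quotient v hv]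
  revert t
  exact noroot_eleven

end CertificatePrime

end Summit.ABC.IUTFork.Broberg

end
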